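import Mathlib
import HarnessLib
import HarnessLib.Audit
import Summits.SmoothPoincare4.Statement
import HarnessLib.Audit.Status.Attr

/-!
Route: RealQuotientSpheres

DORMANT since 2026-08-22T20:47:17Z (reconciler: no traction for 5.6 d (last activity item-evidence-added at 2026-08-17T04:36:10Z); parked, not closed — `ledger route dormant route-SmoothPoincare4-RealQuotientSpheres --off` to reactivate) — unstaffed, not closed; items shared with open routes are served there. `ledger route dormant <id> --off` reactivates.

# Route RealQuotientSpheres — Arnold–Rokhlin quotient spheres of totally anti-invariant real
surfaces — real ℚ-Gorenstein smoothing is a ball swap downstairs, the residue a census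

Negative-side route realising card real-ksba-quotient-spheres (spine). A REAL SURFACE is a compact
complex surface X with an
anti-holomorphic involution σ; its Arnold–Rokhlin quotient Y = X/σ carries a smooth structure making
q : X → Y a 2-fold covering
branched along the real part X_ℝ = Fix σ (Finashin1996 p.1). Call (X,σ) TOTALLY ANTI-INVARIANT if X
is simply connected, X_ℝ ≠ ∅ and
σ_* = −1 on H₂(X;ℚ); then (support RqHomotopySphere) Y is a homotopy 4-sphere, and conversely these
are exactly the real surfaces with
Y ≃ S⁴ (b₂(Y) = dim H₂(X;ℚ)^σ, b₂⁺(Y) = p_g(X)). It suffices to show X = RqExotic: some totally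
anti-invariant real surface has a
quotient sphere not diffeomorphic to S⁴ (stated for every smooth structure on X/σ in which q is a
standard-model branched double cover,
so that no choice in the Arnold–Rokhlin smoothing matters). The INFORMATIVE content is on the other
side: the ranked cruxes say which
members are standard (real ℚ-Gorenstein/KSBA smoothings: a ball swap downstairs, crux
RqWahlBallSwap) and whether general-type members
exist at all (RqGeneralTypeMember); RqStandard (= ¬X classically, proved in Sketch.lean) is the kill
switch.
Lean: `∃ (X : Type) (_ : TopologicalSpace X) (_ : T2Space X) (_ : SecondCountableTopology X) (_ :
CompactSpace X) (_ : ChartedSpace (Fin 2 → ℂ) X) (_ : IsManifold 𝓘(ℂ, Fin 2 → ℂ) ω X) (_ :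
SimplyConnectedSpace X) (σ : X → X) (hσ : Continuous σ), (∀ x, σ (σ x) = x) ∧ (∃ x, σ x = x) ∧ (∀ (U
: Set X) (f : X → ℂ), IsOpen U → MDifferentiableOn 𝓘(ℂ, Fin 2 → ℂ) 𝓘(ℂ, ℂ) f U → MDifferentiableOn
𝓘(ℂ, Fin 2 → ℂ) 𝓘(ℂ, ℂ) (fun x => starRingEnd ℂ (f (σ x))) (σ ⁻¹' U)) ∧
((AlgebraicTopology.singularHomologyFunctor (ModuleCat.{0} ℚ) 2).obj (ModuleCat.of ℚ ℚ)).map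
(TopCat.ofHom ⟨σ, hσ⟩) = -(CategoryTheory.CategoryStruct.id _) ∧ ∀ (Y : Type) [TopologicalSpace Y]
[T2Space Y] [SecondCountableTopology Y] [ChartedSpace (EuclideanSpace ℝ (Fin 4)) Y] [IsManifold (𝓡
4) ∞ Y] (q : X → Y), (Topology.IsQuotientMap q ∧ (∀ x y, q x = q y ↔ (y = x ∨ y = σ x)) ∧ ContMDiff
𝓘(ℝ, Fin 2 → ℂ) (𝓡 4) ∞ q ∧ (∀ x, σ x ≠ x → IsLocalDiffeomorphAt 𝓘(ℝ, Fin 2 → ℂ) (𝓡 4) ∞ q x) ∧ (∀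
x, σ x = x → ∃ φ ∈ IsManifold.maximalAtlas 𝓘(ℝ, Fin 2 → ℂ) ∞ X, ∃ ψ ∈ IsManifold.maximalAtlas (𝓡 4)
∞ Y, x ∈ φ.source ∧ ∀ y ∈ φ.source, σ y ∈ φ.source ∧ q y ∈ ψ.source ∧ φ (σ y) 0 = starRingEnd ℂ (φ y
0) ∧ φ (σ y) 1 = starRingEnd ℂ (φ y 1) ∧ ψ (q y) 0 = (φ y 0).re ∧ ψ (q y) 1 = (φ y 1).re ∧ ψ (q y) 2
= (φ y 0).im ^ 2 - (φ y 1).im ^ 2 ∧ ψ (q y) 3 = 2 * (φ y 0).im * (φ y 1).im)) → IsEmpty (Y ≃ₘ⟮𝓡 4, 𝓡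
4⟯ (Metric.sphere (0 : EuclideanSpace ℝ (Fin 5)) 1))`

## Assembly
Pure logic (Sketch.lean `assembly_provable : Assembly`, sorry-free, `lean check` rc 0): RqExotic
gives (X,σ); RqQuotientExists gives a
standard-model quotient (Y,q); RqHomotopySphere gives e : Y ≃ₕ S⁴; SmoothPoincare4 unfolds to ∀ M
(T2, second countable) ∀ atlas,
M ≃ₕ S⁴ → Nonempty (M ≃ₘ S⁴), contradicting the IsEmpty clause of RqExotic at (Y,q). The statements
use only Mathlib vocabulary and
the summit binder, so no fact-bearing Literature file enters the route's import cone.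

Rationale: WHY THIS LINE. Kuiper–Massey (ℂℙ²/conj ≅ S⁴, Kuiper1974, Massey1973) is the first line of a table:
every totally anti-invariant real surface
MANUFACTURES a homotopy 4-sphere double-covered by a rigid algebraic object, and Finashin's CDQ
programme (Finashin1996, Finashin1997,
FinashinKreckViro1988, Akbulut1994, Finashin1999 §2.3–2.4 local version) shows the rational and
Dolgachev rungs give S⁴ — with EXOTIC
covers (Dolgachev D_{p,q} over the standard S⁴, FKV). New here: (i) the b₂(Y) = 0 slice isolated as
a sphere factory (totally
anti-invariant ⇒ X_ℝ is a connected M-surface with χ(X_ℝ) = 2 − b₂(X), Smith + Lefschetz); (ii) the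
post-2007 simply connected
p_g = 0 surfaces of general type (LeePark2007, ParkParkShin2009) are ℚ-Gorenstein smoothings of
rational surfaces with Wahl
singularities 1/p²(1,pq−1) (Wahl1981, KollarShepherdBarron1988), definable over ℝ; by Finashin's
local principle the quotient sphere
of a real smoothing X_t is Y(resolution) with 4-balls (Finashin1999 Thm 2.1.1: real Wahl chains are
SF) traded for the conjugation
quotients Δ_{p,q} of the Milnor fibres B_{p,q} (CassonHarer1981, Lisca2007, FintushelStern1997): Y_t
≅ #ᵢ Θ_{pᵢ,qᵢ} with
Θ_{p,q} := Δ_{p,q} ∪ B⁴ a CANONICAL homotopy 4-sphere attached to each Wahl singularity (one real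
smoothing form for p odd) — upstairs a
rational blow-down creating general type, downstairs a swap of homotopy balls, conjecturally of
genuine balls; (iii) Θ is already S⁴
on the Markov/Hacking–Prokhorov rung (ℙ² ⇝ ℙ(a²,b²,c²), HackingProkhorov2010 + Finashin1997 +
Kuiper–Massey), which dispatches the
card's cheapest falsifier (p,q) = (2,1). Imported area: real algebraic geometry of surfaces
(DegtyarevItenbergKharlamov2000;
classification of real structures up to real deformation makes the family enumerable) and
KSBA/ℚ-Gorenstein deformation theory;
no invariant of Y is used, and the one invariant of the PAIR (X,σ) now available — Real
Seiberg–Witten degree (Miyazawa2023,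
Baraglia2026) — is defined for every totally anti-invariant general-type member ((K² − sign)/8 = 1 =
b⁺^{−σ}) but detects involutions,
not quotients, so it is recorded as context, not engine. No other route of this summit uses real
structures, branched covers by
algebraic surfaces or singularity smoothings; negatives index empty.

RANKED CRUXES. #0 RqExotic (target) — there is a totally anti-invariant real surface (X compact
complex surface, simply connected, σ anti-holomorphic involution with a fixed point, σ_* = −1 on
H₂(X;ℚ)) such that every smooth 4-manifold Y presented as a standard-model branched double quotient
of (X,σ) (q : X → Y a smooth topological quotient map with σ-orbit fibres, a local diffeomorphism
off Fix σ, and of the form (a,b,c,d) ↦ (a,c,b²−d²,2bd) in σ-adapted charts at fixed points) is not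
diffeomorphic to S⁴. (why it might fail: every member may be standard: rational (Finashin1997) and
Dolgachev (FinashinKreckViro1988) rungs are S⁴, real-KSBA members are S⁴ if RqWahlBallSwap holds,
and no invariant certifies a quotient exotic (Real SW sees the involution, not Y).) [Finashin1996,
Finashin1999, FinashinKreckViro1988, LeePark2007, Miyazawa2023, Baraglia2026]
#3 RqGeneralTypeMember (crux) — a totally anti-invariant real structure with a real point exists on
some simply connected compact complex surface of GENERAL TYPE — typed as: b₂(X) ≤ 9 and X has no
non-zero holomorphic anticanonical section (a chart-wise holomorphic family transforming by the
Jacobian determinant); for simply connected surfaces with p_g = 0 this excludes rational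
(Riemann–Roch: h⁰(−K) ≥ 1 + K² = 11 − b₂ ≥ 2) and properly elliptic (b₂ = 10) surfaces, leaving
general type. Card refutation (iii) made positive; expected witnesses: real Lee–Park /
Park–Park–Shin surfaces built from totally real cubic-pencil configurations with real Wahl chains
and a real ℚ-Gorenstein smoothing direction (then H₂(X_t;ℚ) = chains^⊥ ⊂ H₂(Z;ℚ) inherits σ_* = −1
from the real blow-up Z of ℂℙ² at real points). [difficulty: M] (why it might fail: the known p_g=0
general-type constructions may force non-real data (conjugate base points, I_n fibres whose
components conj permutes, Wahl chains without real points) so σ_* ≠ −1; then the family is rational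
∪ Dolgachev and closes as all-standard.) [LeePark2007, ParkParkShin2009,
DegtyarevItenbergKharlamov2000, FriedmanQin1995, Finashin1996]
#5 RqStandard (crux) — CDQ at b₂ = 0 (Finashin's CDQ conjecture restricted to quotient spheres): for
every totally anti-invariant real surface (X,σ) some standard-model branched double quotient Y of
(X,σ) is diffeomorphic to S⁴. Classically equivalent to ¬RqExotic (Sketch.lean
`standard_iff_not_exotic`, sorry-free); its proof closes the route (kill switch) and is a new
standardness theorem for an enumerable infinite family; intended proof = RqWahlBallSwap + real-KSBA
structure theorem + residue census (informal cruxes 2, 4). [deps: RqGeneralTypeMember] [difficulty: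
open-problem] (why it might fail: one Θ_{p,q} (conjugation quotient of a Wahl Milnor fibre, capped)
or one residue quotient (real Barlow / Craighero–Gattazzo-type structure) could be an exotic S⁴;
Finashin's CDQ is open in Kodaira dimension 2 beyond double planes.) [Finashin1996, Finashin1997,
Finashin1999, Akbulut1994, FinashinKreckViro1988, Kuiper1974]
#9 RqHomotopySphere (support) — homotopy-sphere criterion (topological; no smoothness used): X a
compact simply connected topological 4-manifold (charts in ℂ²), σ a continuous involution with a
fixed point acting as −1 on H₂(X;ℚ), Y a topological 4-manifold and q : X → Y a quotient map whose
fibres are the σ-orbits ⇒ Y ≃ₕ S⁴. Proof: π₁(Y) = 1 (Armstrong1968: orbit space of a finite group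
generated by elements with fixed points), H²(Y;ℚ) = H²(X;ℚ)^σ = 0 (transfer, Bredon1972 III /
Bredon1997), Poincaré duality + UCT give H₂(Y;ℤ) = 0, then Freedman–Quinn §10 / tree fact
`nonempty_homotopyEquiv_sphere_four_iff` (spc4.S10). [difficulty: L] [Armstrong1968, Bredon1972,
FreedmanQuinn1990, Finashin1996]
#9 RqQuotientExists (support) — Arnold–Rokhlin CONSTRUCTION (interface/construction split, D-0014):
for every compact complex surface X with an anti-holomorphic involution σ having a fixed point there
is a smooth 4-manifold Y and q : X → Y which is a standard-model branched double quotient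
(topological quotient by σ, smooth, a local diffeomorphism off X_ℝ, and (a,b,c,d) ↦ (a,c,b²−d²,2bd)
in σ-adapted charts along X_ℝ: exponential tubular neighbourhood of the totally real surface X_ℝ,
squaring map on its O(2) normal bundle). [difficulty: L] [Finashin1996, Kuiper1974, Massey1973]

TWO-LAYER PLAN. Filed right after open as informal statement items (no Lean vocabulary yet for
Milnor fibres / real structures; definition requests
below): rank 2 · RqWahlBallSwap · crux — for every Wahl pair (p,q) and every real form of the
ℚ-Gorenstein smoothing
{xy = zᵖ + t}/μ_p (t real) of 1/p²(1,pq−1) with the standard (SF) real structure, the conjugation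
quotient Δ_{p,q} of the Milnor
fibre B_{p,q} is diffeomorphic to B⁴ rel ∂Δ = L(p²,pq−1)/conj = S³; equivalently the canonical
homotopy sphere Θ_{p,q} = Δ ∪ B⁴ is
S⁴; equivalently the real structure on B_{p,q} is the deck involution of a double cover of B⁴
branched along a slice surface of the
2-bridge knot K(p²,pq−1) (CassonHarer1981, Lisca2007). rank 4 · RqRealKsbaStandard · crux — for a
real ℚ-Gorenstein smoothing X_t
(t real) of a real rational surface X₀ with only Wahl singularities whose exceptional chains are
real with real points (SF,
Finashin1999 Thm 2.1.1) and whose minimal resolution is a blow-up of ℂℙ² at real points: Y(X_t) ≅ #ᵢ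
Θ_{pᵢ,qᵢ}, hence ≅ S⁴ given
RqWahlBallSwap. Foreseen glued splits (k ≤ 3, depth 1): RqStandard ⇐ RqRealKsbaStandard →
RqResidueStandard → RqStandard (residue =
totally anti-invariant structures not real-deformation equivalent to real-KSBA / real-log-transform
ones); RqWahlBallSwap ⇐ MarkovRung
(Θ ≅ S⁴ for Wahl singularities on real ℚ-Gorenstein degenerations of del Pezzo surfaces,
HackingProkhorov2010 — provable from
Finashin1997 + Kuiper–Massey by induction over the Markov tree) → GeneralWahl → RqWahlBallSwap.

KILL CRITERIA. RqStandard proved ⇒ RqExotic refuted ⇒ close `refuted:RqExotic` with census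
"Arnold–Rokhlin quotient spheres are standard" (a theorem,
the intended harvest). RqGeneralTypeMember refuted (no general-type member) ⇒ the family is rational
∪ Dolgachev, both standard
(Finashin1997, FinashinKreckViro1988) ⇒ close refuted. RqWahlBallSwap refuted for some (p,q) by an
explicit Θ_{p,q} ≇ S⁴ ⇒ ¬SPC4
outright (the sensational branch). SmoothPoincare4 proved elsewhere ⇒ moot. A theorem "branched
double covers of homotopy 4-spheres
along surfaces are never Kähler unless the base is S⁴" would also close it.

NOT DECOMPOSED YET. The residue census (real structures on Barlow / Craighero–Gattazzo /
Kulikov-type surfaces and on KSBA surfaces with non-SF real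
Wahl points), the real-deformation finiteness per class (DIK-type), the p = 2 extra real forms,
uniqueness of the standard-model
quotient up to diffeomorphism (RqQuotientUnique, believed routine via equivariant tubular
neighbourhoods), and any negative-side
engine (Real Seiberg–Witten degree of (X,σ) versus deck involutions of Σ₂(S⁴,F)) — all layer 2 or
later.

CHEAPEST FALSIFIER. (p,q) = (2,1): is Θ_{2,1} ≅ S⁴? RUN on paper this session: ℙ² is the real
ℚ-Gorenstein smoothing of ℙ(1,1,4) (cone over the Veronese
quartic; resolution F₄ with a real (−4)-section, an SF point), so S⁴ = ℙ²/conj = (Y(F₄) ∖ D⁴) ∪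
Δ_{2,1} = Θ_{2,1} by Finashin1997 (CDQ
for real rational surfaces) — PASSED; likewise every Markov-type Wahl singularity via ℙ² ⇝
ℙ(a²,b²,c²) (HackingProkhorov2010). Next
cheapest, genuinely open: (p,q) = (3,1), singularity 1/9(1,2), chain (−5,−2): compute Δ_{3,1} = ({xy
= z³ + t} ∩ B⁶)/D₃ by the
Lefschetz-fibration-over-a-half-disc picture, or find 1/9(1,2) on a real smoothable log del Pezzo.
Lookup that would downgrade
RqGeneralTypeMember to `known`: an explicit real Lee–Park surface in print (none found: crossref
"anti-holomorphic involution rational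
blowdown", "Q-Gorenstein smoothing real structure Wahl", 0 relevant).

NUMBERS. b₂(Y) = (b₂(X) + χ(X_ℝ) − 2)/2, b₂⁺(Y) = p_g(X) (Finashin1996 p.5); Y ≃ S⁴ ⟺ χ(X_ℝ) = 2 −
b₂(X) ⟺ σ_* = −1; then X_ℝ is connected with
b_*(X_ℝ;𝔽₂) = 2 + b₂(X) (M-surface) and X_ℝ·X_ℝ = b₂(X) − 2. Simply connected p_g = 0: K² = 10 − b₂,
general type ⇒ 1 ≤ b₂ ≤ 9,
known K² = 1,2,3,4 (Barlow, LeePark2007, ParkParkShin2009). Wahl: ∂B_{p,q} = L(p², pq−1),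
π₁(B_{p,q}) = ℤ/p, b₂ = 0; Θ_{p,q} = Θ_{p,p−q};
Markov rung proved on paper: p ∈ {2, 5, 13, 29, 34, …}. Real SW degree defined for all totally
anti-invariant general-type members:
(K² − sign(X))/8 = (10 − b₂ − 2 + b₂)/8 = 1 = b⁺(X)^{−σ} (Baraglia2026 Def 1.1(3), Miyazawa2023).
Items at open: 6 typed (+2 informal).

DEFINITION REQUESTS. `IsBranchedDoubleQuotient σ q` (the standard-model clause above as a named
predicate; topic Summits/SmoothPoincare4/SmoothPoincare4/Theorems
or Literature/Topology/FourManifolds); `IsAntiholomorphic` / `RealStructure` on a complex manifold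
(Literature/Geometry/Kaehler);
`WahlMilnorFibre p q` with its real involution(s) (Literature/AlgebraicGeometry or
Topology/FourManifolds) — needed to type
RqWahlBallSwap and RqRealKsbaStandard. Cite facts wanted: Kuiper–Massey; Finashin1997 (CDQ for real
rational surfaces); Finashin1999 Thm
2.1.1 (SF criterion); Armstrong1968; transfer H*(X/G;ℚ) = H*(X;ℚ)^G.

Novelty: Searches (2026-08-15): `lit frontier SmoothPoincare4 --since 2020` (30 rows; one branched-cover item
arXiv:2605.26337, none real-
algebraic); crossref "quotient of complex surface by complex conjugation" (12: Massey1973,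
Kuiper1974, Akbulut1994, Finashin1996),
"real structures surfaces of general type geometric genus zero" (8: BCP survey, Delaunay toric; 0 on
quotients), "anti-holomorphic
involution rational blowdown real" (0 relevant), "Q-Gorenstein smoothing real structure Wahl
singularity" (0 relevant; KOS 1999
M-smoothings of curve singularities noted), "exotic P2-knots real Seiberg-Witten Miyazawa"
(Baraglia2026 found and READ pp.2-3,36),
"real Godeaux Campedelli involution" (Park–Shin–Urzúa 2013 holomorphic involutions only); `lit read
arXiv:dg-ga/9506007` pp.1-2,5,11
and `arXiv:math/9903112` §2.1–2.4 READ; zbMATH 0 rows; OpenAlex/S2/arXiv/galaxy unavailable this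
session (429 / saturated) — logged.
Nearest prior art found: Finashin1996 (doi:10.1515/crll.1996.481.55; CDQ conjecture,
rational/log-transform rungs, b₂⁺(Y) = p_g),
Finashin1999 (arXiv:math/9903112; SF-singularities, local CDQ Y' = X̄ # Û'), FinashinKreckViro1988,
Akbulut1994 (general-type double
planes with b₂(Y) > 0); on the invariant side Miyazawa2023 / Baraglia2026 (Real SW degree, exotic
involutions with FIXED quotient).
Delta: the b₂(Y) = 0 slice as a homotopy-sphere factory + Finashin's local principle applied to
T-singularity (Wahl) smoothings of the
post-2007 p_g = 0 general-type surfaces, giving the  [refs: 10.1515/crll.1996.481.55, 2605.26337, dg-ga/9506007, math/9903112, doi:10.1515/crll.1996.481.55, Massey1973, Kuiper1974, Akbulut1994, Finashin1996, Baraglia2026, Finashin1999, FinashinKreckViro1988, Miyazawa2023]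

Barriers (technique_class: real-algebraic-quotients, cdq, ksba-ball-swap): - technique_class: real-algebraic-quotients, cdq, ksba-ball-swap
- Literature.Barriers.SmoothPoincare4.ProjectiveRigidityBarrierFour: evaded — the involution lives
UPSTAIRS on X with 2-dimensional fixed set; nothing ℤ/2-equivariant is claimed about the sphere Y,
and the barrier's lesson (exotic involution, standard quotient: FKV, Miyazawa2023, Baraglia2026) is
built in: Real SW is recorded as seeing (X,σ), not Y.
- Literature.Barriers.SmoothPoincare4.CircleActionBarrierFour: consistent — toric/ℂ*-symmetric real
structures give quotients with circle actions, standard by Fintushel–Pao, a sanity check on the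
rational rung only.
- Literature.Barriers.SmoothPoincare4.GaugeSumBarrierFour: not met — no gauge invariant of Y is
used; standardness is by explicit decomposition (ball swap), and the route concedes it has no
exoticness engine.
- Literature.Barriers.SmoothPoincare4.StableBarrierFour: not met — no stabilisation; note Θ_{p,q}
and Miyazawa's M_n dissolve after one ℂℙ²bar, which the route never adds.
- Literature.Barriers.SmoothPoincare4.TopologicalBarrierFour: not met — homeomorphism type is never
the detector; RqHomotopySphere is used only to feed the summit binder.
- Literature.Barriers.SmoothPoincare4.HCobordismBarrierFour: not met — no h-cobordism argument; the
one place products of 3-manifolds with I appear (uniqueness of the quotient smoothing) is kept out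
of the typed thesis by quantifying over all standard-model quotients.
- Literature.Barriers.SmoothPoincare4.SmallExo

Novelty grade: new-combination — refuter route-review rreview-70aad721: concur with the card audit (refuter-novelty-audit-SmoothPoincare4-13-0: new-combination = Finashin's CDQ programme + post-2007 ℚ-Gorenstein p_g=0 surfaces + local ball-swap reading). My additional search (remote APIs 429 this session; local index + crossref 'qu (refuter refuter-rreview-route-SmoothPoincare4-Re-70aad721-0, 2026-08-15T14:07:49Z; prior: arxiv:dg-ga/9506007, arxiv:math/9903112, arxiv:math/0004134, doi:10.1007/bf01432386, doi:10.1007/bf00181480, arxiv:2312.02041)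

History (route lifecycle, newest last):
- 2026-08-15T12:17:43Z · rev 1: dropped stmt-SmoothPoincare4-7655 — drop duplicate item stmt-SmoothPoincare4-7655 (identical re-add of informal crux RqWahlBallSwap = stmt-SmoothPoincare4-7646, made only to read its id); not load (planner-plancard-SmoothPoincare4-SmoothPoinca-8cc681b9-0)
- 2026-08-16T04:19:12Z · AUTO-CRUX (backfill): RqExotic — hypotheses of the deciding theorem that nothing in the route derives are cruxes (operator:999:1085951)
- 2026-08-22T20:47:17Z · DORMANT — reconciler: no traction for 5.6 d (last activity item-evidence-added at 2026-08-17T04:36:10Z); parked, not closed — `ledger route dormant route-SmoothPoincare4- (operator:999:3477861)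

sub-problem: SmoothPoincare4 · status: dormant · opened planner-plancard-SmoothPoincare4-SmoothPoinca-8cc681b9-0 2026-08-15T12:04:25Z · rev 4 · ledger route-SmoothPoincare4-RealQuotientSpheres
GENERATED by the gate from the ledger (D-0016/17). Provers cite these decls: `theorem foo : Summit.SmoothPoincare4.SmoothPoincare4.Theses.RealQuotientSpheres.<Decl> := …` in Summits/SmoothPoincare4/SmoothPoincare4/Theorems/<Name>.lean.
-/

namespace Summit.SmoothPoincare4.SmoothPoincare4.Theses.RealQuotientSpheres

open scoped BigOperators Topology Manifold Classical MeasureTheory ProbabilityTheory Matrix InnerProductSpace ComplexConjugate ContinuousMap ContDiff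
open Filter Set Function TopologicalSpace MeasureTheory

attribute [summit_statement] _root_.SmoothPoincare4

open Literature.SPC4

/-- item stmt-SmoothPoincare4-7151 · crux (kind.auto-crux: conjecture-grade) · rank 0 · open · by planner
why it might fail: every member may be standard: rational (Finashin1997) and Dolgachev (FinashinKreckViro1988) rungs are S⁴, real-KSBA members are S⁴ if RqWahlBallSwap holds, and no invariant certifies a quotient exotic (Real SW sees the involution, not Y).
sources: Finashin1996, Finashin1999, FinashinKreckViro1988, LeePark2007, Miyazawa2023, Baraglia2026
[target] there is a totally anti-invariant real surface (X compact complex surface, simply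
connected, σ anti-holomorphic involution with a fixed point, σ_* = −1 on H₂(X;ℚ)) such that every
smooth 4-manifold Y presented as a standard-model branched double quotient of (X,σ) (q : X → Y a
smooth topological quotient map with σ-orbit fibres, a local diffeomorphism off Fix σ, and of the
form (a,b,c,d) ↦ (a,c,b²−d²,2bd) in σ-adapted charts at fixed points) is not diffeomorphic to S⁴. -/
@[route_item "route-SmoothPoincare4-RealQuotientSpheres", crux]
def RqExotic : Prop :=
  ∃ (X : Type) (_ : TopologicalSpace X) (_ : T2Space X) (_ : SecondCountableTopology X) (_ : CompactSpace X) (_ : ChartedSpace (Fin 2 → ℂ) X) (_ : IsManifold 𝓘(ℂ, Fin 2 → ℂ) ω X) (_ : SimplyConnectedSpace X) (σ : X → X) (hσ : Continuous σ), (∀ x, σ (σ x) = x) ∧ (∃ x, σ x = x) ∧ (∀ (U : Set X) (f : X → ℂ), IsOpen U → MDifferentiableOn 𝓘(ℂ, Fin 2 → ℂ) 𝓘(ℂ, ℂ) f U → MDifferentiableOn 𝓘(ℂ, Fin 2 → ℂ) 𝓘(ℂ, ℂ) (fun x => starRingEnd ℂ (f (σ x))) (σ ⁻¹' U)) ∧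 ((AlgebraicTopology.singularHomologyFunctor (ModuleCat.{0} ℚ) 2).obj (ModuleCat.of ℚ ℚ)).map (TopCat.ofHom ⟨σ, hσ⟩) = -(CategoryTheory.CategoryStruct.id _) ∧ ∀ (Y : Type) [TopologicalSpace Y] [T2Space Y] [SecondCountableTopology Y] [ChartedSpace (EuclideanSpace ℝ (Fin 4)) Y] [IsManifold (𝓡 4) ∞ Y] (q : X → Y), (Topology.IsQuotientMap q ∧ (∀ x y, q x = q y ↔ (y = x ∨ y = σ x)) ∧ ContMDiff 𝓘(ℝ, Fin 2 → ℂ) (𝓡 4) ∞ q ∧ (∀ x, σ x ≠ x → IsLocalDiffeomorphAt 𝓘(ℝ, Fin 2 → ℂ) (𝓡 4) ∞ q x) ∧ (∀ x, σ x = x → ∃ φ ∈ IsManifold.maximalAtlas 𝓘(ℝ, Fin 2 → ℂ) ∞ X, ∃ ψ ∈ IsManifold.maximalAtlas (𝓡 4) ∞ Y, x ∈ φ.source ∧ ∀ y ∈ φ.source, σ y ∈ φ.source ∧ q y ∈ ψ.source ∧ φ (σ y) 0 = starRingEnd ℂ (φ y 0) ∧ φ (σ y) 1 = starRingEnd ℂ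 (φ y 1) ∧ ψ (q y) 0 = (φ y 0).re ∧ ψ (q y) 1 = (φ y 1).re ∧ ψ (q y) 2 = (φ y 0).im ^ 2 - (φ y 1).im ^ 2 ∧ ψ (q y) 3 = 2 * (φ y 0).im * (φ y 1).im)) → IsEmpty (Y ≃ₘ⟮𝓡 4, 𝓡 4⟯ (Metric.sphere (0 : EuclideanSpace ℝ (Fin 5)) 1))

-- item stmt-SmoothPoincare4-7646 · crux · rank 2 · open · by planner — informal only, no Lean statement yet:
--   [crux] RqWahlBallSwap — LOCAL BALL SWAP for T-singularities (card item RQ-LOCAL; Finashin1999 §2.4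
--   "local version of CDQ" specialised to rational-homology-disk smoothings). For every Wahl pair (p,q)
--   (p ≥ 2, 0 < q < p, gcd = 1) consider the ℚ-Gorenstein smoothing of the cyclic quotient singularity
--   1/p²(1, pq−1) written as ({xy = z^p + t} ⊂ ℂ³)/μ_p, μ_p acting by (ζx, ζ⁻¹y, ζ^q z), with its
--   standard real structure (x,y,z,t real; complex conjugation normalises μ_p). For real t ≠ 0 the
--   Milnor fibre B_{p,q} = ({xy = z^p + t} ∩ B⁶)/μ_p (rational homology ball, π₁ = ℤ/p, ∂ = L(p², pq−1);
--   CassonHarer1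

/-- item stmt-SmoothPoincare4-7152 · crux · rank 3 · open · by planner
why it might fail: the known p_g=0 general-type constructions may force non-real data (conjugate base points, I_n fibres whose components conj permutes, Wahl chains without real points) so σ_* ≠ −1; then the family is rational ∪ Dolgachev and closes as all-standard.
sources: LeePark2007, ParkParkShin2009, DegtyarevItenbergKharlamov2000, FriedmanQin1995, Finashin1996
[crux] a totally anti-invariant real structure with a real point exists on some simply connected
compact complex surface of GENERAL TYPE — typed as: b₂(X) ≤ 9 and X has no non-zero holomorphic
anticanonical section (a chart-wise holomorphic family transforming by the Jacobian determinant);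
for simply connected surfaces with p_g = 0 this excludes rational (Riemann–Roch: h⁰(−K) ≥ 1 + K² =
11 − b₂ ≥ 2) and properly elliptic (b₂ = 10) surfaces, leaving general type. Card refutation (iii)
made positive; expected witnesses: real Lee–Park / Park–Park–Shin surfaces built from totally real
cubic-pencil configurations with real Wahl chains and a real ℚ-Gorenstein smoothing direction (then
H₂(X_t;ℚ) = chains^⊥ ⊂ H₂(Z;ℚ) inherits σ_* = −1 from the real blow-up Z of ℂℙ² at real points).
[difficulty: M] -/
@[route_item "route-SmoothPoincare4-RealQuotientSpheres"]
def RqGeneralTypeMember : Prop :=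
  ∃ (X : Type) (_ : TopologicalSpace X) (_ : T2Space X) (_ : SecondCountableTopology X) (_ : CompactSpace X) (_ : ChartedSpace (Fin 2 → ℂ) X) (_ : IsManifold 𝓘(ℂ, Fin 2 → ℂ) ω X) (_ : SimplyConnectedSpace X) (σ : X → X) (hσ : Continuous σ), (∀ x, σ (σ x) = x) ∧ (∃ x, σ x = x) ∧ (∀ (U : Set X) (f : X → ℂ), IsOpen U → MDifferentiableOn 𝓘(ℂ, Fin 2 → ℂ) 𝓘(ℂ, ℂ) f U → MDifferentiableOn 𝓘(ℂ, Fin 2 → ℂ) 𝓘(ℂ, ℂ) (fun x => starRingEnd ℂ (f (σ x))) (σ ⁻¹' U)) ∧ ((AlgebraicTopology.singularHomologyFunctor (ModuleCat.{0} ℚ) 2).obj (ModuleCat.of ℚ ℚ)).map (TopCat.ofHom ⟨σ, hσ⟩) = -(CategoryTheory.CategoryStruct.id _) ∧ Module.finrank ℚ (((AlgebraicTopology.singularHomologyFunctor (ModuleCat.{0} ℚ) 2).obj (ModuleCat.of ℚ ℚ)).obj (TopCat.of X)) ≤ 9 ∧ ¬ ∃ s : OpenPartialHomeomorph X (Fin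 2 → ℂ) → (Fin 2 → ℂ) → ℂ, (∀ φ ∈ atlas (Fin 2 → ℂ) X, DifferentiableOn ℂ (s φ) φ.target) ∧ (∀ φ ∈ atlas (Fin 2 → ℂ) X, ∀ ψ ∈ atlas (Fin 2 → ℂ) X, ∀ x ∈ φ.source ∩ ψ.source, s ψ (ψ x) = LinearMap.det ((fderiv ℂ (ψ ∘ φ.symm) (φ x) : (Fin 2 → ℂ) →ₗ[ℂ] (Fin 2 → ℂ))) * s φ (φ x)) ∧ (∃ φ ∈ atlas (Fin 2 → ℂ) X, ∃ x ∈ φ.source, s φ (φ x) ≠ 0)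

/-- item stmt-SmoothPoincare4-17596 · crux · rank 4 · open · by planner
why it might fail: one general-type member with a STANDARD quotient kills it: a totally anti-invariant real Lee–Park surface (K²=2; five Wahl points, p ∈ {2,3,5,9,15}) has Y ≅ #Θ_{p,q} ≅ S⁴ as soon as RqWahlBallSwap holds for those pairs — exactly what Finashin's CDQ conjecture predicts.
sources: Finashin1996, Finashin1997, FreedmanGompfMorrisonWalker2010, ManolescuPiccirillo2023, LeePark2007, arXiv:math/0609072
[crux] DETECTOR (BC2-redirect piece of the deciding crux RqExotic; crux-strategist 2026-08-17). For
EVERY totally anti-invariant real surface (X,σ) of GENERAL TYPE — the class of RqGeneralTypeMember: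
X simply connected compact complex surface, σ anti-holomorphic involution with a real point, σ_* =
−1 on H₂(X;ℚ), b₂(X) ≤ 9 and no non-zero holomorphic anticanonical section — EVERY standard-model
branched double quotient Y of (X,σ) is not diffeomorphic to S⁴ (Finashin CDQ fails uniformly on the
general-type quotient spheres). Together with RqGeneralTypeMember it gives RqExotic by modus ponens
(glue RqExotic_of_subs, Theorems/RealQuotientSpheresRqExoticSplit.lean); alone it gives neither
RqExotic nor ¬SmoothPoincare4 (the class may be empty). Its NEGATION — one general-type
Arnold–Rokhlin quotient sphere is standard — is the first instance of CDQ at b₂(Y)=0 in Kodaira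
dimension 2 and is the informative target for refuters (RqWahlBallSwap + RqRealKsbaStandard + a
real-KSBA general-type member would prove it). Intended line: FGMW certificate (a knot slice in Y∖B⁴
that is not slice in B⁴) + Palais disc theorem, skeleton Cruxes/RqExotic/Lines/bc2-redirect.lean.
why it might fail: one gener -/
@[route_item "route-SmoothPoincare4-RealQuotientSpheres"]
def RqGeneralTypeDetector : Prop :=
  ∀ (X : Type) [TopologicalSpace X] [T2Space X] [SecondCountableTopology X] [CompactSpace X] [ChartedSpace (Fin 2 → ℂ) X] [IsManifold 𝓘(ℂ, Fin 2 → ℂ) ω X] [SimplyConnectedSpace X] (σ : X → X) (hσ : Continuous σ), (∀ x, σ (σ x) = x) → (∃ x, σ x = x) → (∀ (U : Set X) (f : X → ℂ), IsOpen U → MDifferentiableOn 𝓘(ℂ, Fin 2 → ℂ) 𝓘(ℂ, ℂ) f U → MDifferentiableOn 𝓘(ℂ, Fin 2 → ℂ) 𝓘(ℂ, ℂ) (fun x => starRingEnd ℂ (f (σ x))) (σ ⁻¹' U)) → ((AlgebraicTopology.singularHomologyFunctor (ModuleCat.{0} ℚ) 2).obj (ModuleCat.of ℚ ℚ)).map (TopCat.ofHom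 ⟨σ, hσ⟩) = -(CategoryTheory.CategoryStruct.id _) → Module.finrank ℚ (((AlgebraicTopology.singularHomologyFunctor (ModuleCat.{0} ℚ) 2).obj (ModuleCat.of ℚ ℚ)).obj (TopCat.of X)) ≤ 9 → (¬ ∃ s : OpenPartialHomeomorph X (Fin 2 → ℂ) → (Fin 2 → ℂ) → ℂ, (∀ φ ∈ atlas (Fin 2 → ℂ) X, DifferentiableOn ℂ (s φ) φ.target) ∧ (∀ φ ∈ atlas (Fin 2 → ℂ) X, ∀ ψ ∈ atlas (Fin 2 → ℂ) X, ∀ x ∈ φ.source ∩ ψ.source, s ψ (ψ x) = LinearMap.det ((fderiv ℂ (ψ ∘ φ.symm) (φ x) : (Fin 2 → ℂ) →ₗ[ℂ] (Fin 2 → ℂ))) * s φ (φ x)) ∧ (∃ φ ∈ atlas (Fin 2 → ℂ) X, ∃ x ∈ φ.source, s φ (φ x) ≠ 0)) → ∀ (Y : Type) [TopologicalSpace Y] [T2Space Y] [SecondCountableTopology Y] [ChartedSpace (EuclideanSpace ℝ (Fin 4)) Y] [IsManifold (𝓡 4) ∞ Y] (q : X → Y), (Topology.IsQuotientMap q ∧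 (∀ x y, q x = q y ↔ (y = x ∨ y = σ x)) ∧ ContMDiff 𝓘(ℝ, Fin 2 → ℂ) (𝓡 4) ∞ q ∧ (∀ x, σ x ≠ x → IsLocalDiffeomorphAt 𝓘(ℝ, Fin 2 → ℂ) (𝓡 4) ∞ q x) ∧ (∀ x, σ x = x → ∃ φ ∈ IsManifold.maximalAtlas 𝓘(ℝ, Fin 2 → ℂ) ∞ X, ∃ ψ ∈ IsManifold.maximalAtlas (𝓡 4) ∞ Y, x ∈ φ.source ∧ ∀ y ∈ φ.source, σ y ∈ φ.source ∧ q y ∈ ψ.source ∧ φ (σ y) 0 = starRingEnd ℂ (φ y 0) ∧ φ (σ y) 1 = starRingEnd ℂ (φ y 1) ∧ ψ (q y) 0 = (φ y 0).re ∧ ψ (q y) 1 = (φ y 1).re ∧ ψ (q y) 2 = (φ y 0).im ^ 2 - (φ y 1).im ^ 2 ∧ ψ (q y) 3 = 2 * (φ y 0).im * (φ y 1).im)) → IsEmpty (Y ≃ₘ⟮𝓡 4, 𝓡 4⟯ (Metric.sphere (0 : EuclideanSpace ℝ (Fin 5)) 1))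

-- item stmt-SmoothPoincare4-7647 · crux · rank 4 · open · by planner — informal only, no Lean statement yet:
--   [crux] RqRealKsbaStandard — STRUCTURE THEOREM + standardness for the real-KSBA rung (card item
--   RQ-KSBA). Let X₀ be a projective rational surface over ℝ with only Wahl singularities P₁,…,P_k, all
--   real points whose exceptional chains in the minimal resolution Z consist of real curves with real
--   points meeting at real points (SF points, Finashin1999 Thm 2.1.1), with Z obtained from ℂℙ² by
--   blowing up real points (so σ_* = −1 on H₂(Z;ℚ)); let X_t (t real, small) be a real ℚ-Gorenstein
--   smoothing (LeePark2007, ParkParkShin2009 constructions done with totally real data). STATEMENT: (a)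
--   (X_t, σ) is tota

/-- item stmt-SmoothPoincare4-7153 · crux · rank 5 · open · by planner
why it might fail: one Θ_{p,q} (conjugation quotient of a Wahl Milnor fibre, capped) or one residue quotient (real Barlow / Craighero–Gattazzo-type structure) could be an exotic S⁴; Finashin's CDQ is open in Kodaira dimension 2 beyond double planes.
sources: Finashin1996, Finashin1997, Finashin1999, Akbulut1994, FinashinKreckViro1988, Kuiper1974
[crux] CDQ at b₂ = 0 (Finashin's CDQ conjecture restricted to quotient spheres): for every totally
anti-invariant real surface (X,σ) some standard-model branched double quotient Y of (X,σ) is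
diffeomorphic to S⁴. Classically equivalent to ¬RqExotic (Sketch.lean `standard_iff_not_exotic`,
sorry-free); its proof closes the route (kill switch) and is a new standardness theorem for an
enumerable infinite family; intended proof = RqWahlBallSwap + real-KSBA structure theorem + residue
census (informal cruxes 2, 4). [deps: RqGeneralTypeMember] [difficulty: open-problem] -/
@[route_item "route-SmoothPoincare4-RealQuotientSpheres"]
def RqStandard : Prop :=
  ∀ (X : Type) [TopologicalSpace X] [T2Space X] [SecondCountableTopology X] [CompactSpace X] [ChartedSpace (Fin 2 → ℂ) X] [IsManifold 𝓘(ℂ, Fin 2 → ℂ) ω X] [SimplyConnectedSpace X] (σ : X → X) (hσ : Continuous σ), (∀ x, σ (σ x) = x) → (∃ x, σ x = x) → (∀ (U : Set X) (f : X → ℂ), IsOpen U → MDifferentiableOn 𝓘(ℂ, Fin 2 → ℂ) 𝓘(ℂ, ℂ) f U → MDifferentiableOn 𝓘(ℂ, Fin 2 → ℂ) 𝓘(ℂ, ℂ) (fun x => starRingEnd ℂ (f (σ x))) (σ ⁻¹' U)) → ((AlgebraicTopology.singularHomologyFunctor (ModuleCat.{0} ℚ) 2).obj (ModuleCat.of ℚ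 ℚ)).map (TopCat.ofHom ⟨σ, hσ⟩) = -(CategoryTheory.CategoryStruct.id _) → ∃ (Y : Type) (_ : TopologicalSpace Y) (_ : T2Space Y) (_ : SecondCountableTopology Y) (_ : ChartedSpace (EuclideanSpace ℝ (Fin 4)) Y) (_ : IsManifold (𝓡 4) ∞ Y) (q : X → Y), (Topology.IsQuotientMap q ∧ (∀ x y, q x = q y ↔ (y = x ∨ y = σ x)) ∧ ContMDiff 𝓘(ℝ, Fin 2 → ℂ) (𝓡 4) ∞ q ∧ (∀ x, σ x ≠ x → IsLocalDiffeomorphAt 𝓘(ℝ, Fin 2 → ℂ) (𝓡 4) ∞ q x) ∧ (∀ x, σ x = x → ∃ φ ∈ IsManifold.maximalAtlas 𝓘(ℝ, Fin 2 → ℂ) ∞ X, ∃ ψ ∈ IsManifold.maximalAtlas (𝓡 4) ∞ Y, x ∈ φ.source ∧ ∀ y ∈ φ.source, σ y ∈ φ.source ∧ q y ∈ ψ.source ∧ φ (σ y) 0 = starRingEnd ℂ (φ y 0) ∧ φ (σ y) 1 = starRingEnd ℂ (φ y 1) ∧ ψ (q y) 0 = (φ y 0).re ∧ ψ (q y) 1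 = (φ y 1).re ∧ ψ (q y) 2 = (φ y 0).im ^ 2 - (φ y 1).im ^ 2 ∧ ψ (q y) 3 = 2 * (φ y 0).im * (φ y 1).im)) ∧ Nonempty (Y ≃ₘ⟮𝓡 4, 𝓡 4⟯ (Metric.sphere (0 : EuclideanSpace ℝ (Fin 5)) 1))

/-- item stmt-SmoothPoincare4-7154 · support · rank 9 · open · by planner
sources: Armstrong1968, Bredon1972, FreedmanQuinn1990, Finashin1996
[support] homotopy-sphere criterion (topological; no smoothness used): X a compact simply connected
topological 4-manifold (charts in ℂ²), σ a continuous involution with a fixed point acting as −1 on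
H₂(X;ℚ), Y a topological 4-manifold and q : X → Y a quotient map whose fibres are the σ-orbits ⇒ Y
≃ₕ S⁴. Proof: π₁(Y) = 1 (Armstrong1968: orbit space of a finite group generated by elements with
fixed points), H²(Y;ℚ) = H²(X;ℚ)^σ = 0 (transfer, Bredon1972 III / Bredon1997), Poincaré duality +
UCT give H₂(Y;ℤ) = 0, then Freedman–Quinn §10 / tree fact `nonempty_homotopyEquiv_sphere_four_iff`
(spc4.S10). [difficulty: L] -/
@[route_item "route-SmoothPoincare4-RealQuotientSpheres", crux]
def RqHomotopySphere : Prop :=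
  ∀ (X : Type) [TopologicalSpace X] [T2Space X] [SecondCountableTopology X] [CompactSpace X] [ChartedSpace (Fin 2 → ℂ) X] [SimplyConnectedSpace X] (σ : X → X) (hσ : Continuous σ), (∀ x, σ (σ x) = x) → (∃ x, σ x = x) → ((AlgebraicTopology.singularHomologyFunctor (ModuleCat.{0} ℚ) 2).obj (ModuleCat.of ℚ ℚ)).map (TopCat.ofHom ⟨σ, hσ⟩) = -(CategoryTheory.CategoryStruct.id _) → ∀ (Y : Type) [TopologicalSpace Y] [T2Space Y] [SecondCountableTopology Y] [ChartedSpace (EuclideanSpace ℝ (Fin 4)) Y] (q : X → Y), Topology.IsQuotientMap q → (∀ x y, q x = q y ↔ (y = x ∨ y = σ x)) → Nonempty (Y ≃ₕ (Metric.sphere (0 : EuclideanSpace ℝ (Fin 5)) 1))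

/-- item stmt-SmoothPoincare4-7155 · support · rank 9 · open · by planner
sources: Finashin1996, Kuiper1974, Massey1973
[support] Arnold–Rokhlin CONSTRUCTION (interface/construction split, D-0014): for every compact
complex surface X with an anti-holomorphic involution σ having a fixed point there is a smooth
4-manifold Y and q : X → Y which is a standard-model branched double quotient (topological quotient
by σ, smooth, a local diffeomorphism off X_ℝ, and (a,b,c,d) ↦ (a,c,b²−d²,2bd) in σ-adapted charts
along X_ℝ: exponential tubular neighbourhood of the totally real surface X_ℝ, squaring map on its
O(2) normal bundle). [difficulty: L] -/
@[route_item "route-SmoothPoincare4-RealQuotientSpheres", crux]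
def RqQuotientExists : Prop :=
  ∀ (X : Type) [TopologicalSpace X] [T2Space X] [SecondCountableTopology X] [CompactSpace X] [ChartedSpace (Fin 2 → ℂ) X] [IsManifold 𝓘(ℂ, Fin 2 → ℂ) ω X] (σ : X → X) (hσ : Continuous σ), (∀ x, σ (σ x) = x) → (∃ x, σ x = x) → (∀ (U : Set X) (f : X → ℂ), IsOpen U → MDifferentiableOn 𝓘(ℂ, Fin 2 → ℂ) 𝓘(ℂ, ℂ) f U → MDifferentiableOn 𝓘(ℂ, Fin 2 → ℂ) 𝓘(ℂ, ℂ) (fun x => starRingEnd ℂ (f (σ x))) (σ ⁻¹' U)) → ∃ (Y : Type) (_ : TopologicalSpace Y) (_ : T2Space Y) (_ : SecondCountableTopology Y) (_ : ChartedSpace (EuclideanSpace ℝ (Fin 4)) Y) (_ : IsManifold (𝓡 4) ∞ Y) (q : X → Y), Topology.IsQuotientMap q ∧ (∀ x y, q x = q y ↔ (y = x ∨ y = σ x)) ∧ ContMDiff 𝓘(ℝ, Fin 2 → ℂ) (𝓡 4) ∞ q ∧ (∀ x, σ x ≠ x → IsLocalDiffeomorphAt 𝓘(ℝ, Fin 2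 → ℂ) (𝓡 4) ∞ q x) ∧ (∀ x, σ x = x → ∃ φ ∈ IsManifold.maximalAtlas 𝓘(ℝ, Fin 2 → ℂ) ∞ X, ∃ ψ ∈ IsManifold.maximalAtlas (𝓡 4) ∞ Y, x ∈ φ.source ∧ ∀ y ∈ φ.source, σ y ∈ φ.source ∧ q y ∈ ψ.source ∧ φ (σ y) 0 = starRingEnd ℂ (φ y 0) ∧ φ (σ y) 1 = starRingEnd ℂ (φ y 1) ∧ ψ (q y) 0 = (φ y 0).re ∧ ψ (q y) 1 = (φ y 1).re ∧ ψ (q y) 2 = (φ y 0).im ^ 2 - (φ y 1).im ^ 2 ∧ ψ (q y) 3 = 2 * (φ y 0).im * (φ y 1).im)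

/-- item stmt-SmoothPoincare4-7156 · assembly · rank 1 · open · by planner
sources: Finashin1996, FreedmanQuinn1990
[assembly] RqHomotopySphere → RqQuotientExists → RqExotic → ¬ SmoothPoincare4. -/
@[route_item "route-SmoothPoincare4-RealQuotientSpheres"]
def Assembly : Prop :=
  RqHomotopySphere → RqQuotientExists → RqExotic → ¬ SmoothPoincare4

/-! D-0027 §2.1 — DECIDING THEOREM (planner-authored via `route open/edit --closes-file`; by planner-rbadge-SmoothPoincare4-RealQuotientSph-fbb42410-g4-0 2026-08-15T16:11:46Z):
its hypotheses are this route's items and its conclusion the sub-problem Statement (glue_lint), and it elaborates with this file. -/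

@[closes "route-SmoothPoincare4-RealQuotientSpheres"] theorem closes (hH : RqHomotopySphere) (hQ : RqQuotientExists) (hE : RqExotic) :
    ¬ _root_.SmoothPoincare4 := by
  intro hS
  obtain ⟨X, _, _, _, _, _, _, _, σ, hσ, hinv, hfix, hanti, hneg, hall⟩ := hE
  obtain ⟨Y, _, _, _, _, _, q, hquot, hfib, hsmooth, hloc, hmodel⟩ := hQ X σ hσ hinv hfix hanti
  have hempty := hall Y q ⟨hquot, hfib, hsmooth, hloc, hmodel⟩
  obtain ⟨e⟩ := hH X σ hσ hinv hfix hneg Y q hquot hfib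
  have hne : Nonempty (Y ≃ₘ⟮𝓡 4, 𝓡 4⟯ (Metric.sphere (0 : EuclideanSpace ℝ (Fin 5)) 1)) := hS Y ‹_› ‹_› e
  exact hempty.false hne.some

end Summit.SmoothPoincare4.SmoothPoincare4.Theses.RealQuotientSpheres
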